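import Literature.NumberTheory.EllipticCurves.PadicSigmaSqInvXVariableChangeProofs
import Literature.NumberTheory.EllipticCurves.PadicSigmaSqMinusTwistUniquenessProofs
import Literature.NumberTheory.EllipticCurves.QuadraticTwistJInvariantProofs
import Literature.NumberTheory.EllipticCurves.VariableChangePointsMap
import HarnessLib

/-!
# The minus-twist sigma-squared height and its receptacle are MODEL-FREE: transport along an integral
# isomorphism `D • V = V₂`, `u = ±1`, `r, s, t ∈ ℤ` (proofs only)

Topic `Literature/NumberTheory/EllipticCurves` (trunk T-NT-EC). Pure proof file (no definition, no named fact, no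
`sorry`), sequel of `PadicSigmaSqMinusTwist.lean` (the receptacle `PAdicHeightData.IsCanonicalSqMinusTwist`:
`⟨P,P⟩ = log_p den x′ − log_p 𝔖_p(1/x′)`, `x′ = X/d`, on admissible `P ∈ V^{(d)}(ℚ)`), of
`PadicSigmaSqMinusTwistUniquenessProofs.lean` (admissible multiples, uniqueness of the datum) and of
`PadicSigmaSqInvXVariableChangeProofs.lean` (`𝔖_p(V)(w) = u⁻²𝔖_p(D • V)(u²w/(1 − rw))`). Width seat
`bsd-line-cf2-p1-w8` (g30) of the cell `bsd-print-cf2`, in support of stmt-BirchSwinnertonDyer-20368: the research stub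
(Δ1) `stub_law_descent_two` of road (C) `disegni-pair-two` quantifies over EVERY globally minimal model `V` of
`49a1^{(d′)}` and every canonical datum `Dc` on `V^{(d*)}`; two such models differ by `D = (±1, r, s, t)`, `r, s, t ∈ ℤ`
(Silverman VII.1.3(b)), and this file shows that the height `Dc.pairing P P` read on either model is the same number.
BSD is not proved by any of this.

## Contents

For `V/ℚ`, `D = (u, r, s, t)` with `u = ±1`, `r ∈ ℤ` (and `s, t ∈ ℤ` where `p`-integrality is needed), `V₂ = D • V`:
the twist models are related by `D^{(d)} = (u, d·r, 0, 0)` (`quadraticTwist_smul`), so `x(P) ↦ x − d·r` and the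
RATIONAL abscissa `x′ = x/d` of the attached point of `V(ℚ(√d))⁻` moves by the INTEGER `−r`.
* §1 plumbing: `‖x′ − r‖_p = ‖x′‖_p` off the unit ball, `ord_ℓ(x′ − r) < 0 ↔ ord_ℓ x′ < 0`.
* §2 `hasNonsingularMinusReductionAt_iff_of_smul_eq` — the odd-prime local condition is model-free
  (`4f_{V₂}(X) = 4f_V(X + r)`: `b₂ ↦ b₂ + 12r`, `b₄ ↦ b₄ + rb₂ + 6r²`, `b₆ ↦ b₆ + 2rb₄ + r²b₂ + 4r³`).
* §3 `minusTwistLocalConditions_iff_of_smul_eq`, `isAdmissibleMinusTwist_iff_of_smul_eq` — admissibility is model-free,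
  for any additive isomorphism `φ : V^{(d)}(ℚ) ≃+ V₂^{(d)}(ℚ)` acting on abscissae by `x ↦ x − d·r`
  (e.g. `pointEquiv` of `D^{(d)}`: `minusTwist_pointEquiv_some`).
* §4 `canonicalPAdicHeightSqMinusTwist_eq_of_smul_eq` — **the height formula is model-free**:
  `den(x′ − r) = den x′` and `𝔖_p(V)(1/x′) = 𝔖_p(V₂)(1/(x′ − r))` (the value form of the `𝔖`-transport with
  `u² = 1`).
* §5 (`p = 2`, `d ∈ {−1, 2, −2}`) `IsCanonicalSqMinusTwist.pairing_map_map_eq` — **canonical data on two models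
  agree**: `Dc₂.pairing (φ P) (φ Q) = Dc.pairing P Q` (admissible multiples + polarisation,
  `pairing_eq_of_sq_eq_on`).

## Sources

* B. Mazur, W. Stein, J. Tate, Doc. Math. Extra Vol. Coates (2006), §1 eq. (1.1) and the remark «extends uniquely …
  `h_p(nQ) = n²h_p(Q)`». [MazurSteinTate2006]
* B. Mazur, J. Tate, Duke Math. J. 62 (1991), §3, Thm. 3.1 (`σ_{(E,λω)} = λσ_{(E,ω)}`: `σ²` only sees `u² = 1`).
  [MazurTate1991]
* J. H. Silverman, *The Arithmetic of Elliptic Curves*, 2nd ed. (2009), III.1 Table 3.1, VII.1.3(b). [SilvermanAEC2009]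
* K. Rubin, A. Silverberg, Bull. AMS 39 (2002), §1 (quadratic twists). [RubinSilverberg2002]
-/

noncomputable section

open scoped Classical
open PowerSeries Literature.NumberTheory.EllipticCurves

namespace WeierstrassCurve

/-! ### §1 Plumbing: integer shifts of a rational number -/

section Plumbing

variable {p : ℕ} [Fact p.Prime]

/-- `‖x′ − r‖_p = ‖x′‖_p` for `‖x′‖_p > 1` and `r ∈ ℤ` (ultrametric inequality; private plumbing). [folklore] -/
private theorem norm_ratCast_sub_intCast_of_one_lt {q : ℚ} (hq : 1 < ‖((q : ℚ) : ℚ_[p])‖) (r : ℤ) :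
    ‖(((q - r : ℚ)) : ℚ_[p])‖ = ‖((q : ℚ) : ℚ_[p])‖ := by
  have hr : ‖((r : ℤ) : ℚ_[p])‖ ≤ 1 := Padic.norm_int_le_one r
  have hne : ‖((q : ℚ) : ℚ_[p])‖ ≠ ‖(-((r : ℤ) : ℚ_[p]))‖ := by
    rw [norm_neg]; exact (lt_of_le_of_lt hr hq).ne'
  push_cast
  rw [sub_eq_add_neg, Padic.add_eq_max_of_ne hne, norm_neg, max_eq_left (le_of_lt (lt_of_le_of_lt hr hq))]

/-- `‖x′‖_p > 1 ↔ ‖x′ − r‖_p > 1` for `r ∈ ℤ` (private plumbing). [folklore] -/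
private theorem one_lt_norm_ratCast_sub_intCast_iff (q : ℚ) (r : ℤ) :
    1 < ‖(((q - r : ℚ)) : ℚ_[p])‖ ↔ 1 < ‖((q : ℚ) : ℚ_[p])‖ := by
  refine ⟨fun h => ?_, fun h => by rwa [norm_ratCast_sub_intCast_of_one_lt h]⟩
  have := norm_ratCast_sub_intCast_of_one_lt h (-r)
  push_cast at this
  rw [sub_neg_eq_add, sub_add_cancel] at this
  rw [this]; exact_mod_cast h

/-- `ord_ℓ(x′ + r) = ord_ℓ x′` for `ord_ℓ x′ < 0`, `r ∈ ℤ` (private plumbing). [folklore] -/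
private theorem padicValRat_add_intCast_of_neg' {q : ℚ} (hq : padicValRat p q < 0) (c : ℤ) :
    padicValRat p (q + c) = padicValRat p q := by
  by_cases hc : c = 0
  · simp [hc]
  have hq0 : q ≠ 0 := by rintro rfl; simp at hq
  have hcv : 0 ≤ padicValRat p (c : ℚ) := by
    rw [padicValRat.of_int]; exact_mod_cast (Nat.cast_nonneg _)
  have hlt : padicValRat p q < padicValRat p (c : ℚ) := lt_of_lt_of_le hq hcv
  refine padicValRat.add_eq_of_lt ?_ hq0 (Int.cast_ne_zero.mpr hc) hlt
  intro h
  have : q = -(c : ℚ) := eq_neg_of_add_eq_zero_left h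
  rw [this, padicValRat.neg] at hlt
  exact lt_irrefl _ hlt

/-- `ord_ℓ(x′ − r) < 0 ↔ ord_ℓ x′ < 0` for `r ∈ ℤ` (private plumbing). [folklore] -/
private theorem padicValRat_sub_intCast_neg_iff (q : ℚ) (r : ℤ) :
    padicValRat p (q - r) < 0 ↔ padicValRat p q < 0 := by
  refine ⟨fun h => ?_, fun h => ?_⟩
  · have := padicValRat_add_intCast_of_neg' h r
    rw [sub_add_cancel] at this
    rwa [← this] at h
  · have := padicValRat_add_intCast_of_neg' h (-r)
    push_cast at this
    rw [← sub_eq_add_neg] at this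
    rwa [this]

end Plumbing

/-! ### §2 The odd-prime local condition is model-free -/

section OddPrimes

variable {V V₂ : WeierstrassCurve ℚ} {D : VariableChange ℚ}

/-- The `b`-invariants of `V₂ = D • V` for `u = ±1`: `b₂ + 12r`, `b₄ + rb₂ + 6r²`, `b₆ + 2rb₄ + r²b₂ + 4r³`
(Silverman III.1 Table 3.1 with `u² = 1`; private plumbing). [folklore] -/
private theorem b_of_smul_eq (hD : D • V = V₂) (hu : D.u = 1 ∨ D.u = -1) :
    V₂.b₂ = V.b₂ + 12 * D.r ∧ V₂.b₄ = V.b₄ + D.r * V.b₂ + 6 * D.r ^ 2 ∧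
      V₂.b₆ = V.b₆ + 2 * D.r * V.b₄ + D.r ^ 2 * V.b₂ + 4 * D.r ^ 3 := by
  subst hD
  have hu2 : ((D.u⁻¹ : ℚˣ) : ℚ) ^ 2 = 1 := by
    rcases hu with h | h <;> simp [h]
  have hu4 : ((D.u⁻¹ : ℚˣ) : ℚ) ^ 4 = 1 := by rw [show (4 : ℕ) = 2 * 2 from rfl, pow_mul, hu2, one_pow]
  have hu6 : ((D.u⁻¹ : ℚˣ) : ℚ) ^ 6 = 1 := by rw [show (6 : ℕ) = 2 * 3 from rfl, pow_mul, hu2, one_pow]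
  refine ⟨?_, ?_, ?_⟩
  · rw [variableChange_b₂, hu2, one_mul]
  · rw [variableChange_b₄, hu4, one_mul]
  · rw [variableChange_b₆, hu6, one_mul]

/-- **The odd-prime local condition of the minus-twist receptacle is model-free.** For `D • V = V₂` with `u = ±1`,
`r ∈ ℤ`: `HasNonsingularMinusReductionAt V₂ d ℓ (x′ − r) ↔ HasNonsingularMinusReductionAt V d ℓ x′` — the completed
cubics satisfy `f_{V₂}(X − r) = f_V(X)`, `f′_{V₂}(X − r) = f′_V(X)`, and `ord_ℓ(x′ − r) < 0 ↔ ord_ℓ x′ < 0`.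
[Mazur–Stein–Tate 2006, §1; Silverman AEC III.1 Table 3.1, VII.1] [cite: MazurSteinTate2006, §1] -/
theorem hasNonsingularMinusReductionAt_iff_of_smul_eq (hD : D • V = V₂) (hu : D.u = 1 ∨ D.u = -1) {r : ℤ}
    (hr : D.r = r) (d : ℚ) (ℓ : ℕ) [Fact ℓ.Prime] (x' : ℚ) :
    V₂.HasNonsingularMinusReductionAt d ℓ (x' - r) ↔ V.HasNonsingularMinusReductionAt d ℓ x' := by
  obtain ⟨hb₂, hb₄, hb₆⟩ := b_of_smul_eq hD hu
  rw [hr] at hb₂ hb₄ hb₆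
  have hf : (x' - r) ^ 3 + V₂.b₂ / 4 * (x' - r) ^ 2 + V₂.b₄ / 2 * (x' - r) + V₂.b₆ / 4 =
      x' ^ 3 + V.b₂ / 4 * x' ^ 2 + V.b₄ / 2 * x' + V.b₆ / 4 := by
    rw [hb₂, hb₄, hb₆]; ring
  have hf' : 3 * (x' - r) ^ 2 + V₂.b₂ / 2 * (x' - r) + V₂.b₄ / 2 = 3 * x' ^ 2 + V.b₂ / 2 * x' + V.b₄ / 2 := by
    rw [hb₂, hb₄]; ring
  simp only [HasNonsingularMinusReductionAt, hf, hf', padicValRat_sub_intCast_neg_iff]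

end OddPrimes

/-! ### §3 Admissibility is model-free -/

section Admissible

variable {V V₂ : WeierstrassCurve ℚ} {D : VariableChange ℚ} (p : ℕ) [Fact p.Prime] (d : ℚ)

/-- **The point isomorphism of the twist models attached to `D • V = V₂`.** With `D^{(d)} = (u, d·r, 0, 0)` one has
`D^{(d)} • V^{(d)} = V₂^{(d)}` (`quadraticTwist_smul`), and for `u = ±1` the induced isomorphism
`V^{(d)}(ℚ) ≃+ V₂^{(d)}(ℚ)` (`pointEquiv` followed by the transport along that equality) acts on affine points by
`(x, y) ↦ (x − d·r, u⁻³y)`: its abscissa is SHIFTED BY `−d·r`. [Rubin–Silverberg 2002, §1; Silverman AEC III.1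
Table 3.1] [cite: RubinSilverberg2002, §1] -/
theorem minusTwist_pointEquiv_some (hu : D.u = 1 ∨ D.u = -1)
    (hDd : (⟨D.u, d * D.r, 0, 0⟩ : VariableChange ℚ) • V.quadraticTwist d = V₂.quadraticTwist d)
    {x y : ℚ} (h : (V.quadraticTwist d).toAffine.Nonsingular x y) :
    ∃ (x₂ y₂ : ℚ) (h₂ : (V₂.quadraticTwist d).toAffine.Nonsingular x₂ y₂),
      ((VariableChange.pointEquiv (V.quadraticTwist d) ⟨D.u, d * D.r, 0, 0⟩).trans
          (Affine.Point.congrEquiv hDd)) (.some x y h) = .some x₂ y₂ h₂ ∧ x₂ = x - d * D.r := by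
  refine ⟨_, _, _, by rw [AddEquiv.trans_apply, VariableChange.pointEquiv_some, Affine.Point.congrEquiv_some], ?_⟩
  rw [VariableChange.toX_def]
  rcases hu with h1 | h1 <;> simp [h1]

/-- The equality of twist models `D^{(d)} • V^{(d)} = V₂^{(d)}` attached to `D • V = V₂`
(`quadraticTwist_smul`, restated). [cite: RubinSilverberg2002, §1] -/
theorem twistedChange_smul_quadraticTwist_eq (hD : D • V = V₂) :
    (⟨D.u, d * D.r, 0, 0⟩ : VariableChange ℚ) • V.quadraticTwist d = V₂.quadraticTwist d := by
  rw [← quadraticTwist_smul, hD]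

variable {p d}

/-- **The local conditions of the minus-twist receptacle are model-free.** For `D • V = V₂` (`u = ±1`, `r ∈ ℤ`),
`d ≠ 0`, and any additive isomorphism `φ : V^{(d)}(ℚ) ≃+ V₂^{(d)}(ℚ)` shifting abscissae by `−d·r`:
`MinusTwistLocalConditions V₂ p d (φ P) ↔ MinusTwistLocalConditions V p d P` (the rational abscissa `x′ = x/d` of
the attached `ℚ(√d)`-point moves by the integer `−r`: norms at `p` off the unit ball, the sigma disc, the odd-prime
condition and the `2`-adic pole condition are all unchanged). [Mazur–Stein–Tate 2006, §1] [cite: MazurSteinTate2006, §1] -/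
theorem minusTwistLocalConditions_iff_of_smul_eq (hD : D • V = V₂) (hu : D.u = 1 ∨ D.u = -1) {r : ℤ}
    (hr : D.r = r) (hd : d ≠ 0) (φ : (V.quadraticTwist d).toAffine.Point ≃+ (V₂.quadraticTwist d).toAffine.Point)
    (hφ : ∀ {x y : ℚ} (h : (V.quadraticTwist d).toAffine.Nonsingular x y),
      ∃ (x₂ y₂ : ℚ) (h₂ : (V₂.quadraticTwist d).toAffine.Nonsingular x₂ y₂),
        φ (.some x y h) = .some x₂ y₂ h₂ ∧ x₂ = x - d * D.r)
    (P : (V.quadraticTwist d).toAffine.Point) :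
    V₂.MinusTwistLocalConditions p d (φ P) ↔ V.MinusTwistLocalConditions p d P := by
  rcases P with _ | ⟨x, y, h⟩
  · rw [show (Affine.Point.zero : (V.quadraticTwist d).toAffine.Point) = 0 from rfl, map_zero]
    exact Iff.rfl
  obtain ⟨x₂, y₂, h₂, hφP, hx₂⟩ := hφ h
  rw [hφP]
  have hx₂d : x₂ / d = x / d - r := by rw [hx₂, hr]; field_simp
  show (1 < ‖((x₂ / d : ℚ) : ℚ_[p])‖ ∧ ‖(((x₂ / d : ℚ) : ℚ_[p]))⁻¹‖ < (p : ℝ) ^ (-(2 / ((p : ℝ) - 1))) ∧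
      (∀ ℓ : ℕ, ℓ.Prime → ℓ ≠ p → ℓ ≠ 2 → V₂.HasNonsingularMinusReductionAt d ℓ (x₂ / d)) ∧
      (p ≠ 2 → padicValRat 2 (x₂ / d) < 0)) ↔
    (1 < ‖((x / d : ℚ) : ℚ_[p])‖ ∧ ‖(((x / d : ℚ) : ℚ_[p]))⁻¹‖ < (p : ℝ) ^ (-(2 / ((p : ℝ) - 1))) ∧
      (∀ ℓ : ℕ, ℓ.Prime → ℓ ≠ p → ℓ ≠ 2 → V.HasNonsingularMinusReductionAt d ℓ (x / d)) ∧
      (p ≠ 2 → padicValRat 2 (x / d) < 0))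
  rw [hx₂d]
  have h1 : 1 < ‖(((x / d - r : ℚ)) : ℚ_[p])‖ ↔ 1 < ‖((x / d : ℚ) : ℚ_[p])‖ :=
    one_lt_norm_ratCast_sub_intCast_iff (x / d) r
  have h3 : (∀ ℓ : ℕ, ℓ.Prime → ℓ ≠ p → ℓ ≠ 2 → V₂.HasNonsingularMinusReductionAt d ℓ (x / d - r)) ↔
      (∀ ℓ : ℕ, ℓ.Prime → ℓ ≠ p → ℓ ≠ 2 → V.HasNonsingularMinusReductionAt d ℓ (x / d)) := by
    refine forall_congr' fun ℓ => forall_congr' fun hℓ => ?_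
    haveI := Fact.mk hℓ
    rw [hasNonsingularMinusReductionAt_iff_of_smul_eq hD hu hr d ℓ (x / d)]
  have h4 : (p ≠ 2 → padicValRat 2 (x / d - r) < 0) ↔ (p ≠ 2 → padicValRat 2 (x / d) < 0) := by
    rw [padicValRat_sub_intCast_neg_iff (p := 2) (x / d) r]
  rw [h3, h4]
  constructor
  · rintro ⟨hn, hdisc, hodd, htwo⟩
    have hn' := h1.mp hn
    refine ⟨hn', ?_, hodd, htwo⟩
    rw [norm_inv] at hdisc ⊢
    rwa [norm_ratCast_sub_intCast_of_one_lt hn'] at hdisc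
  · rintro ⟨hn, hdisc, hodd, htwo⟩
    refine ⟨h1.mpr hn, ?_, hodd, htwo⟩
    rw [norm_inv] at hdisc ⊢
    rwa [norm_ratCast_sub_intCast_of_one_lt hn]

/-- **Admissibility for the minus-twist receptacle is model-free** (non-torsion is preserved by the isomorphism
`φ`; local conditions by `minusTwistLocalConditions_iff_of_smul_eq`). [Mazur–Stein–Tate 2006, §1]
[cite: MazurSteinTate2006, §1] -/
theorem isAdmissibleMinusTwist_iff_of_smul_eq (hD : D • V = V₂) (hu : D.u = 1 ∨ D.u = -1) {r : ℤ}
    (hr : D.r = r) (hd : d ≠ 0) (φ : (V.quadraticTwist d).toAffine.Point ≃+ (V₂.quadraticTwist d).toAffine.Point)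
    (hφ : ∀ {x y : ℚ} (h : (V.quadraticTwist d).toAffine.Nonsingular x y),
      ∃ (x₂ y₂ : ℚ) (h₂ : (V₂.quadraticTwist d).toAffine.Nonsingular x₂ y₂),
        φ (.some x y h) = .some x₂ y₂ h₂ ∧ x₂ = x - d * D.r)
    (P : (V.quadraticTwist d).toAffine.Point) :
    V₂.IsAdmissibleMinusTwist p d (φ P) ↔ V.IsAdmissibleMinusTwist p d P := by
  have htor : IsOfFinAddOrder (φ P) ↔ IsOfFinAddOrder P :=
    φ.injective.isOfFinAddOrder_iff (f := φ.toAddMonoidHom)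
  unfold IsAdmissibleMinusTwist
  rw [minusTwistLocalConditions_iff_of_smul_eq hD hu hr hd φ hφ P, htor]

end Admissible

/-! ### §4 The height formula is model-free -/

section Height

variable {V V₂ : WeierstrassCurve ℚ} {D : VariableChange ℚ} {p : ℕ} [Fact p.Prime] {d : ℚ}

/-- Base change to `ℚ_p` of an integral change of variables with `u = ±1` is `p`-integral with `u ∈ ℤ_pˣ`
(private plumbing; Summit-side twin `variableChange_map_padic_integral`). [folklore] -/
private theorem map_padic_integral (hu : D.u = 1 ∨ D.u = -1) {r s t : ℤ} (hr : D.r = r) (hs : D.s = s)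
    (ht : D.t = t) :
    ‖((D.map (algebraMap ℚ ℚ_[p])).u : ℚ_[p])‖ = 1 ∧ ‖(D.map (algebraMap ℚ ℚ_[p])).r‖ ≤ 1 ∧
      ‖(D.map (algebraMap ℚ ℚ_[p])).s‖ ≤ 1 ∧ ‖(D.map (algebraMap ℚ ℚ_[p])).t‖ ≤ 1 := by
  refine ⟨?_, ?_, ?_, ?_⟩
  · show ‖(algebraMap ℚ ℚ_[p] (D.u : ℚ))‖ = 1
    rcases hu with h | h <;> simp [h]
  · show ‖algebraMap ℚ ℚ_[p] D.r‖ ≤ 1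
    rw [hr]; simpa using Padic.norm_int_le_one (p := p) r
  · show ‖algebraMap ℚ ℚ_[p] D.s‖ ≤ 1
    rw [hs]; simpa using Padic.norm_int_le_one (p := p) s
  · show ‖algebraMap ℚ ℚ_[p] D.t‖ ≤ 1
    rw [ht]; simpa using Padic.norm_int_le_one (p := p) t

/-- **THE MINUS-TWIST SIGMA-SQUARED HEIGHT IS MODEL-FREE.** Let `V/ℚ` be `ℤ`-integral with `log_{V ⊗ ℚ_p}` of
unbounded denominators (e.g. `a₁` odd at `p = 2`, or good reduction), `D • V = V₂` with `u = ±1`, `r, s, t ∈ ℤ`, and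
suppose `V₂ ⊗ ℚ_p` carries a sigma-squared pair. For any additive isomorphism `φ : V^{(d)}(ℚ) ≃+ V₂^{(d)}(ℚ)` shifting
abscissae by `−d·r` and every `P` satisfying the local conditions:
`canonicalPAdicHeightSqMinusTwist V₂ p d (φ P) = canonicalPAdicHeightSqMinusTwist V p d P` — `den(x′ − r) = den x′` and
`𝔖_p(V)(1/x′) = 𝔖_p(V₂)(1/(x′ − r))` (the value form of the `𝔖`-transport, `u² = 1`,
`(1/x′)/(1 − r/x′) = 1/(x′ − r)`). [Mazur–Stein–Tate 2006, §1 eq. (1.1); Mazur–Tate 1991, §3]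
[cite: MazurSteinTate2006, §1 eq. (1.1)] [cite: MazurTate1991, Thm. 3.1] -/
theorem canonicalPAdicHeightSqMinusTwist_eq_of_smul_eq [V.IsIntegral ℤ] (hD : D • V = V₂)
    (hu : D.u = 1 ∨ D.u = -1) {r s t : ℤ} (hr : D.r = r) (hs : D.s = s) (ht : D.t = t)
    (hlog : ∀ N : ℕ, ∃ m, (p : ℝ) ^ N < ‖coeff m (V.baseChange ℚ_[p]).formalLog‖)
    (hex : ∃ Sq : ℚ_[p]⟦X⟧, ∃ c, (V₂.baseChange ℚ_[p]).IsMazurTateSigmaSqPair Sq c) (hd : d ≠ 0)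
    (φ : (V.quadraticTwist d).toAffine.Point ≃+ (V₂.quadraticTwist d).toAffine.Point)
    (hφ : ∀ {x y : ℚ} (h : (V.quadraticTwist d).toAffine.Nonsingular x y),
      ∃ (x₂ y₂ : ℚ) (h₂ : (V₂.quadraticTwist d).toAffine.Nonsingular x₂ y₂),
        φ (.some x y h) = .some x₂ y₂ h₂ ∧ x₂ = x - d * D.r)
    {P : (V.quadraticTwist d).toAffine.Point} (hP : V.MinusTwistLocalConditions p d P) :
    V₂.canonicalPAdicHeightSqMinusTwist p d (φ P) = V.canonicalPAdicHeightSqMinusTwist p d P := by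
  subst hD
  rcases P with _ | ⟨x, y, h⟩
  · exact hP.elim
  obtain ⟨x₂, y₂, h₂, hφP, hx₂⟩ := hφ h
  have hn : 1 < ‖((x / d : ℚ) : ℚ_[p])‖ := hP.1
  have hx₂d : x₂ / d = x / d - r := by rw [hx₂, hr]; field_simp
  -- the sigma-squared term: `𝔖_p(V)(1/x′) = 𝔖_p(D • V)(1/(x′ − r))`
  obtain ⟨hu', hr', hs', ht'⟩ := map_padic_integral (p := p) hu hr hs ht
  have ha0 : ((x / d : ℚ) : ℚ_[p]) ≠ 0 := fun h0 => by
    rw [h0, norm_zero] at hn; exact not_lt.mpr zero_le_one hn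
  have hw : ‖(((x / d : ℚ) : ℚ_[p]))⁻¹‖ < 1 := by rw [norm_inv]; exact inv_lt_one_of_one_lt₀ hn
  have h𝔖 := padicSigmaSqInvXEval_eq_of_variableChange (V := V) (D := D) hlog hu' hr' hs' ht' hex hw
  have hu2 : (((D.map (algebraMap ℚ ℚ_[p])).u : ℚ_[p]ˣ) : ℚ_[p]) ^ 2 = 1 := by
    show (algebraMap ℚ ℚ_[p] (D.u : ℚ)) ^ 2 = 1
    rcases hu with h1 | h1 <;> simp [h1]
  have hui2 : (((D.map (algebraMap ℚ ℚ_[p])).u⁻¹ : ℚ_[p]ˣ) : ℚ_[p]) ^ 2 = 1 := by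
    rw [Units.val_inv_eq_inv_val, inv_pow, hu2, inv_one]
  have hrp : (D.map (algebraMap ℚ ℚ_[p])).r = ((r : ℤ) : ℚ_[p]) := by
    show algebraMap ℚ ℚ_[p] D.r = _; rw [hr]; simp
  have hcast : (((x / d - r : ℚ)) : ℚ_[p]) = ((x / d : ℚ) : ℚ_[p]) - ((r : ℤ) : ℚ_[p]) := by
    rw [Rat.cast_sub, Rat.cast_intCast]
  have hmob : (((x / d : ℚ) : ℚ_[p]))⁻¹ * (1 - ((r : ℤ) : ℚ_[p]) * (((x / d : ℚ) : ℚ_[p]))⁻¹)⁻¹ =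
      ((((x / d - r : ℚ)) : ℚ_[p]))⁻¹ := by
    rw [hcast, ← mul_inv]
    congr 1
    rw [mul_sub, mul_one, mul_left_comm, mul_inv_cancel₀ ha0, mul_one]
  rw [hui2, one_mul, hu2, one_mul, hrp, hmob] at h𝔖
  rw [hφP, canonicalPAdicHeightSqMinusTwist_some, canonicalPAdicHeightSqMinusTwist_some, hx₂d,
    Rat.sub_intCast_den, h𝔖]

end Height

/-! ### §5 `p = 2`: canonical data on two models of the twist agree -/

section Pairing

variable {V V₂ : WeierstrassCurve ℚ} {D : VariableChange ℚ}

/-- **CANONICAL MINUS-TWIST DATA ON TWO MODELS AGREE** (`p = 2`, `d ∈ {−1, 2, −2}`). Let `V/ℚ` be elliptic and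
`ℤ`-integral with `log_{V ⊗ ℚ₂}` of unbounded denominators, `D • V = V₂` with `u = ±1`, `r, s, t ∈ ℤ`, `V₂ ⊗ ℚ₂`
carrying a sigma-squared pair, and `φ : V^{(d)}(ℚ) ≃+ V₂^{(d)}(ℚ)` an additive isomorphism shifting abscissae by
`−d·r` (e.g. the `pointEquiv` of `D^{(d)}`, `minusTwist_pointEquiv_some`). If `Dc` resp. `Dc₂` satisfy
`IsCanonicalSqMinusTwist` on `V^{(d)}` resp. `V₂^{(d)}`, then `Dc₂.pairing (φ P) (φ Q) = Dc.pairing P Q` for all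
`P, Q`: both are symmetric bilinear torsion-vanishing pairings on `V^{(d)}(ℚ)` agreeing on `⟨Q,Q⟩` for admissible
`Q` (§3–§4), and every non-torsion point has an admissible multiple (`exists_isAdmissibleMinusTwist_nsmul`).
So the canonical minus-twist `2`-adic height of a point does not depend on the globally minimal model it is read
on. [Mazur–Stein–Tate 2006, §1 («extends uniquely … h_p(nQ) = n²h_p(Q)»); Silverman AEC VII.1.3(b)]
[cite: MazurSteinTate2006, §1] [cite: SilvermanAEC2009, VII.1.3(b)] -/
theorem PAdicHeightData.IsCanonicalSqMinusTwist.pairing_map_map_eq [V.IsElliptic] [V.IsIntegral ℤ]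
    (hD : D • V = V₂) (hu : D.u = 1 ∨ D.u = -1) {r s t : ℤ} (hr : D.r = r) (hs : D.s = s) (ht : D.t = t)
    (hlog : ∀ N : ℕ, ∃ m, (2 : ℝ) ^ N < ‖coeff m (V.baseChange ℚ_[2]).formalLog‖)
    (hex : ∃ Sq : ℚ_[2]⟦X⟧, ∃ c, (V₂.baseChange ℚ_[2]).IsMazurTateSigmaSqPair Sq c)
    {d : ℤ} (hd : d = -1 ∨ d = 2 ∨ d = -2)
    (φ : (V.quadraticTwist (d : ℚ)).toAffine.Point ≃+ (V₂.quadraticTwist (d : ℚ)).toAffine.Point)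
    (hφ : ∀ {x y : ℚ} (h : (V.quadraticTwist (d : ℚ)).toAffine.Nonsingular x y),
      ∃ (x₂ y₂ : ℚ) (h₂ : (V₂.quadraticTwist (d : ℚ)).toAffine.Nonsingular x₂ y₂),
        φ (.some x y h) = .some x₂ y₂ h₂ ∧ x₂ = x - (d : ℚ) * D.r)
    {Dc : PAdicHeightData (V.quadraticTwist (d : ℚ)) 2} {Dc₂ : PAdicHeightData (V₂.quadraticTwist (d : ℚ)) 2}
    (hDc : Dc.IsCanonicalSqMinusTwist) (hDc₂ : Dc₂.IsCanonicalSqMinusTwist)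
    (P Q : (V.quadraticTwist (d : ℚ)).toAffine.Point) :
    Dc₂.pairing (φ P) (φ Q) = Dc.pairing P Q := by
  have hd0 : (d : ℚ) ≠ 0 := by rcases hd with rfl | rfl | rfl <;> norm_num
  have hp : ((2 : ℕ) : ℝ) = 2 := by norm_num
  have hlog' : ∀ N : ℕ, ∃ m, ((2 : ℕ) : ℝ) ^ N < ‖coeff m (V.baseChange ℚ_[2]).formalLog‖ := by
    simpa only [hp] using hlog
  set B₂ : (V.quadraticTwist (d : ℚ)).toAffine.Point →+ (V.quadraticTwist (d : ℚ)).toAffine.Point →+ ℚ_[2] :=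
    (Dc₂.pairing.comp φ.toAddMonoidHom).compl₂ φ.toAddMonoidHom with hB₂
  have hB₂apply : ∀ P Q, B₂ P Q = Dc₂.pairing (φ P) (φ Q) := fun P Q => rfl
  have key := pairing_eq_of_sq_eq_on Dc.pairing B₂ Dc.symm
    (fun P Q => by rw [hB₂apply, hB₂apply, Dc₂.symm])
    Dc.map_torsion
    (fun P Q hP => by rw [hB₂apply]; exact Dc₂.map_torsion _ _ (φ.toAddMonoidHom.isOfFinAddOrder hP))
    {P | V.IsAdmissibleMinusTwist 2 (d : ℚ) P} (V.exists_isAdmissibleMinusTwist_nsmul d hd)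
    (fun Q hQ => by
      rw [hB₂apply, hDc Q hQ,
        hDc₂ (φ Q) ((isAdmissibleMinusTwist_iff_of_smul_eq (p := 2) hD hu hr hd0 φ hφ Q).mpr hQ),
        canonicalPAdicHeightSqMinusTwist_eq_of_smul_eq hD hu hr hs ht hlog' hex hd0 φ hφ hQ.2])
  rw [← hB₂apply, ← key]

end Pairing

end WeierstrassCurve

end
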